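import Mathlib.Analysis.SpecialFunctions.Integrals.Basic
import Mathlib.Analysis.SpecialFunctions.Log.Basic
import Mathlib.MeasureTheory.Integral.Prod
import Mathlib.MeasureTheory.Group.Integral
import Mathlib.MeasureTheory.Measure.Haar.Unique
import HarnessLib

/-!
# Logarithmic energy of a neutral density: the layer identity and the diagonal-slots bound

Topic `Analysis/Potential`, namespace `Literature.Analysis.Potential`. For a bounded measurable
density `η : ℝ → ℝ` vanishing off `[-L, L]` write `D(s) := ∫ (∫_x^{x+s} η)² dx` (the squared
increments of the primitive of `η` at scale `s`). PROVED here, by a derivative-free "layer"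
argument (Fubini + one explicit kernel; no Fourier analysis, no Sobolev spaces):

* `integral_sq_intervalIntegral_eq` — the **square identity** `D(s) = ∬ η(u)η(v)(s - |u-v|)₊ du dv`
  (`s ≥ 0`): expand the square and integrate out the window position;
* `integral_posPart_div_sq` — the **layer kernel** `∫₀ᴿ (s-r)₊ s⁻² ds = log R - log r - 1 + r/R`
  (`0 < r ≤ R`), i.e. `-log r` is, up to the affine term `log R - 1 + r/R`, a positive combination
  of the tent kernels `(s - r)₊`;
* `integral_sq_div_sq_eq_kernel` — the **layer identity**
  `∫₀ᴿ s⁻² D(s) ds = ∬ η(u)η(v)(log R - log|u-v| - 1 + |u-v|/R) du dv` (`R ≥ 2L`);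
* `integral_sq_div_sq_le_neg_logEnergy` — for a NEUTRAL density (`∫ η = 0`):
  **`∫₀¹ s⁻² D(s) ds ≤ -∬ η(u)η(v) log|u-v| du dv`** (let `R → ∞`; the affine terms contribute
  `(log R - 1)(∫η)² = 0` and `O(1/R)`, and `D ≥ 0`). This is the positivity of the logarithmic
  energy of a neutral compactly supported charge (Saff–Totik, *Logarithmic Potentials with External
  Fields*, Lemma I.1.8) together with the part of Vershik–Kerov's `H^{1/2}` identity
  `-∬ log|x-y| g'(x)g'(y) = ½‖g‖²_{1/2}` (Vershik–Kerov 1985, Lemma 3; Mkrtchyan 2012, Prop. 4.1)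
  that is needed for LOWER bounds;
* `sum_sq_div_two_le_integral_sq_div_sq` — the **diagonal-slots bound**: if on each unit slot
  `[k, k+1)`, `k ∈ K ⊆ ℤ`, `η` keeps a sign and `|η| ≥ n_k`, then `½ ∑_k n_k² ≤ ∫₀¹ s⁻² D(s) ds`
  (Vershik–Kerov 1985, §3: "consider only the diagonal unit squares").

Together: `¼ ∑_k n_k² ≤ -½ ∬ ηη log|u-v|`, the quadratic-term estimate in the Vershik–Kerov upper
bound for `max_{λ ⊢ N} dim λ` (`Literature/RepresentationTheory/FiniteGroups/VershikKerov*`), where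
`η = 1_{ascending slots of λ} - F_{arcsine}`. A companion development by the four-variable route
(`LogEnergyKernels.lean` ff.) proves the same inequality in Vershik–Kerov's original `H^{1/2}` form.

## References

* A. M. Vershik, S. V. Kerov, Funct. Anal. Appl. 19 (1985) 21–31, Lemma 3 and §3. [VershikKerov1985]
* S. Mkrtchyan, Europ. J. Combin. 33 (2012), arXiv:1008.3854, Prop. 4.1. [Mkrtchyan2012]
* E. B. Saff, V. Totik, *Logarithmic Potentials with External Fields* (1997), Lemma I.1.8.

## Mathlib

`MeasureTheory.integrable_prod_iff(')`, `MeasureTheory.integral_integral_swap`,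
`MeasureTheory.integral_prod_mul`, `MeasureTheory.Measure.prod_apply`, `integral_biUnion_finset`,
`intervalIntegral.integral_eq_sub_of_hasDerivAt`, `intervalIntegral.continuous_primitive`,
`intervalIntegral.integral_mono_interval`, `Integrable.comp_sub_left` (translation invariance,
whence the import of `Haar.Unique` for `IsNegInvariant volume`). Theorems only; no definitions.
-/

noncomputable section

open _root_.MeasureTheory _root_.Set _root_.Filter intervalIntegral
open scoped BigOperators Topology

namespace Literature.Analysis.Potential

/-- A bounded a.e.-strongly measurable function vanishing outside a set of finite measure is
integrable. [folklore] -/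
theorem integrable_of_bounded_of_eq_zero_off {α : Type*} [MeasurableSpace α] {μ : Measure α}
    {f : α → ℝ} {S : Set α} {C : ℝ} (hf : AEStronglyMeasurable f μ) (hS : MeasurableSet S)
    (hμS : μ S ≠ ⊤) (hC : ∀ z, |f z| ≤ C) (h0 : ∀ z ∉ S, f z = 0) : Integrable f μ := by
  refine Integrable.mono' ((integrableOn_const (C := C) hμS).integrable_indicator hS) hf
    (Eventually.of_forall fun z => ?_)
  by_cases hz : z ∈ S
  · rw [indicator_of_mem hz, Real.norm_eq_abs]; exact hC z
  · rw [indicator_of_notMem hz, h0 z hz, norm_zero]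

/-- **Integrability of a two-point kernel against bounded compactly supported densities.**
If `φ, χ` are measurable, bounded, and vanish outside `[-L, L]`, and `κ` is integrable on
`[-2L, 2L]`, then `(x, y) ↦ φ(x) χ(y) κ(x - y)` is integrable on `ℝ²`. [folklore] -/
theorem integrable_mul_mul_kernel {φ χ κ : ℝ → ℝ} {C L : ℝ}
    (hφm : Measurable φ) (hχm : Measurable χ) (hκm : Measurable κ)
    (hφC : ∀ x, |φ x| ≤ C) (hχC : ∀ x, |χ x| ≤ C)
    (hφ0 : ∀ x ∉ Icc (-L) L, φ x = 0) (hχ0 : ∀ x ∉ Icc (-L) L, χ x = 0)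
    (hκ : IntegrableOn κ (Icc (-(2 * L)) (2 * L))) :
    Integrable (fun p : ℝ × ℝ => φ p.1 * χ p.2 * κ (p.1 - p.2)) (volume.prod volume) := by
  have hC0 : 0 ≤ C := (abs_nonneg _).trans (hφC 0)
  -- the truncated kernel
  set κ' : ℝ → ℝ := (Icc (-(2 * L)) (2 * L)).indicator κ with hκ'
  have hκ'i : Integrable κ' := hκ.integrable_indicator measurableSet_Icc
  have hκ'm : Measurable κ' := hκm.indicator measurableSet_Icc
  -- pointwise the integrand equals the truncated one
  have hpt : ∀ x y, φ x * χ y * κ (x - y) = φ x * χ y * κ' (x - y) := by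
    intro x y
    by_cases hx : x ∈ Icc (-L) L
    · by_cases hy : y ∈ Icc (-L) L
      · have hxy : x - y ∈ Icc (-(2 * L)) (2 * L) := by
          constructor <;> linarith [hx.1, hx.2, hy.1, hy.2]
        rw [hκ', indicator_of_mem hxy]
      · rw [hχ0 y hy]; simp
    · rw [hφ0 x hx]; simp
  have hmeas : AEStronglyMeasurable (fun p : ℝ × ℝ => φ p.1 * χ p.2 * κ (p.1 - p.2))
      (volume.prod volume) :=
    (((hφm.comp measurable_fst).mul (hχm.comp measurable_snd)).mul
      (hκm.comp (measurable_fst.sub measurable_snd))).aestronglyMeasurable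
  rw [integrable_prod_iff hmeas]
  constructor
  · refine Eventually.of_forall fun x => ?_
    simp only
    have h1 : Integrable (fun y => κ' (x - y)) := hκ'i.comp_sub_left x
    have h2 : Integrable (fun y => χ y * κ' (x - y)) :=
      h1.bdd_mul hχm.aestronglyMeasurable (Eventually.of_forall fun y => by
        rw [Real.norm_eq_abs]; exact hχC y)
    have h3 : Integrable (fun y => φ x * (χ y * κ' (x - y))) := h2.const_mul (φ x)
    refine h3.congr (Eventually.of_forall fun y => ?_)
    simp only
    rw [hpt x y]; ring
  · -- the norm integral is bounded by `C * C * ∫ |κ'|` and vanishes off `[-L, L]`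
    set M : ℝ := ∫ t, |κ' t| with hM
    have hbound : ∀ x, ∫ y, ‖φ x * χ y * κ (x - y)‖ ≤ C * (C * M) := by
      intro x
      have h1 : ∀ y, ‖φ x * χ y * κ (x - y)‖ ≤ C * (C * |κ' (x - y)|) := by
        intro y
        rw [hpt x y, Real.norm_eq_abs, abs_mul, abs_mul, mul_assoc]
        exact mul_le_mul (hφC x) (mul_le_mul_of_nonneg_right (hχC y) (abs_nonneg _))
          (mul_nonneg (abs_nonneg _) (abs_nonneg _)) hC0
      have h2 : Integrable (fun y => C * (C * |κ' (x - y)|)) :=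
        (((hκ'i.comp_sub_left x).abs).const_mul C).const_mul C
      calc ∫ y, ‖φ x * χ y * κ (x - y)‖ ≤ ∫ y, C * (C * |κ' (x - y)|) :=
            integral_mono_of_nonneg (Eventually.of_forall fun y => norm_nonneg _) h2
              (Eventually.of_forall h1)
        _ = C * (C * M) := by
            rw [MeasureTheory.integral_const_mul, MeasureTheory.integral_const_mul, hM]
            congr 2
            exact integral_sub_left_eq_self (fun t => |κ' t|) volume x
    have hzero : ∀ x ∉ Icc (-L) L, ∫ y, ‖φ x * χ y * κ (x - y)‖ = 0 := by
      intro x hx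
      simp [hφ0 x hx]
    refine integrable_of_bounded_of_eq_zero_off (C := C * (C * M)) hmeas.norm.integral_prod_right'
      measurableSet_Icc (by simp) (fun x => ?_) hzero
    rw [abs_of_nonneg (integral_nonneg fun y => norm_nonneg _)]
    exact hbound x

/-! ### The square identity `∫ (∫_x^{x+s} η)² dx = ∬ η(u)η(v)(s - |u-v|)₊` -/

/-- Pointwise: the product of the two window indicators, as a function of the window position `x`,
is the indicator of `[max(u,v) - s, min(u,v))`. [folklore] -/
theorem indicator_Ioc_mul_indicator_Ioc (η : ℝ → ℝ) (s u v x : ℝ) :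
    (Ioc x (x + s)).indicator η u * (Ioc x (x + s)).indicator η v =
      (Ico (max u v - s) (min u v)).indicator (fun _ => η u * η v) x := by
  by_cases h : x ∈ Ico (max u v - s) (min u v)
  · rw [indicator_of_mem h]
    have h1 := h.1; have h2 := h.2
    have hu : u ∈ Ioc x (x + s) :=
      ⟨lt_of_lt_of_le h2 (min_le_left _ _), by linarith [le_max_left u v]⟩
    have hv : v ∈ Ioc x (x + s) :=
      ⟨lt_of_lt_of_le h2 (min_le_right _ _), by linarith [le_max_right u v]⟩
    rw [indicator_of_mem hu, indicator_of_mem hv]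
  · rw [indicator_of_notMem h]
    by_cases hu : u ∈ Ioc x (x + s)
    · have hv : v ∉ Ioc x (x + s) := by
        intro hv
        exact h ⟨by rw [sub_le_iff_le_add]; exact max_le hu.2 hv.2, lt_min hu.1 hv.1⟩
      rw [indicator_of_notMem hv, mul_zero]
    · rw [indicator_of_notMem hu, zero_mul]

/-- `vol [max(u,v) - s, min(u,v)) = (s - |u - v|)₊`. [folklore] -/
theorem volume_real_Ico_max_sub_min (s u v : ℝ) :
    volume.real (Ico (max u v - s) (min u v)) = max (s - |u - v|) 0 := by
  rw [Real.volume_real_Ico]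
  congr 1
  rcases le_total u v with h | h
  · rw [max_eq_right h, min_eq_left h, abs_of_nonpos (by linarith)]; ring
  · rw [max_eq_left h, min_eq_right h, abs_of_nonneg (by linarith)]; ring

/-- **The square identity.** For a bounded measurable `η` vanishing off `[-L, L]` and `s ≥ 0`:
`∫ (∫_x^{x+s} η)² dx = ∬ η(u) η(v) (s - |u - v|)₊ du dv` (expand the square and integrate out the
window position `x`: the windows `(x, x+s]` containing both `u` and `v` have total length
`(s - |u-v|)₊`). [folklore] -/
theorem integral_sq_intervalIntegral_eq {η : ℝ → ℝ} {C L s : ℝ} (hηm : Measurable η)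
    (hηC : ∀ x, |η x| ≤ C) (hη0 : ∀ x ∉ Icc (-L) L, η x = 0) (hs : 0 ≤ s) :
    ∫ x, (∫ t in x..x + s, η t) ^ 2 =
      ∫ p : ℝ × ℝ, η p.1 * η p.2 * max (s - |p.1 - p.2|) 0 := by
  have hC0 : 0 ≤ C := (abs_nonneg _).trans (hηC 0)
  have hI : ∀ x, ∫ t in x..x + s, η t = ∫ t, (Ioc x (x + s)).indicator η t := by
    intro x
    rw [integral_of_le (by linarith), MeasureTheory.integral_indicator measurableSet_Ioc]
  have hsq : ∀ x, (∫ t, (Ioc x (x + s)).indicator η t) ^ 2 =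
      ∫ p : ℝ × ℝ, (Ioc x (x + s)).indicator η p.1 * (Ioc x (x + s)).indicator η p.2 := by
    intro x
    rw [sq, Measure.volume_eq_prod, ← integral_prod_mul]
  simp_rw [hI, hsq]
  -- the integrand on `ℝ × (ℝ × ℝ)`
  set A : ℝ → ℝ × ℝ → ℝ := fun x p =>
    (Ioc x (x + s)).indicator η p.1 * (Ioc x (x + s)).indicator η p.2 with hA
  have hAm : Measurable (Function.uncurry A) := by
    have h1 : Measurable fun q : ℝ × (ℝ × ℝ) => (Ioc q.1 (q.1 + s)).indicator η q.2.1 := by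
      have : (fun q : ℝ × (ℝ × ℝ) => (Ioc q.1 (q.1 + s)).indicator η q.2.1) =
          fun q => if q.1 < q.2.1 ∧ q.2.1 ≤ q.1 + s then η q.2.1 else 0 := by
        ext q; simp [indicator, mem_Ioc]
      rw [this]
      refine Measurable.ite ?_ (hηm.comp measurable_snd.fst) measurable_const
      exact (measurableSet_lt measurable_fst measurable_snd.fst).inter
        (measurableSet_le measurable_snd.fst (measurable_fst.add_const s))
    have h2 : Measurable fun q : ℝ × (ℝ × ℝ) => (Ioc q.1 (q.1 + s)).indicator η q.2.2 := by
      have : (fun q : ℝ × (ℝ × ℝ) => (Ioc q.1 (q.1 + s)).indicator η q.2.2) =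
          fun q => if q.1 < q.2.2 ∧ q.2.2 ≤ q.1 + s then η q.2.2 else 0 := by
        ext q; simp [indicator, mem_Ioc]
      rw [this]
      refine Measurable.ite ?_ (hηm.comp measurable_snd.snd) measurable_const
      exact (measurableSet_lt measurable_fst measurable_snd.snd).inter
        (measurableSet_le measurable_snd.snd (measurable_fst.add_const s))
    exact h1.mul h2
  have hAint : Integrable (Function.uncurry A) (volume.prod volume) := by
    refine integrable_of_bounded_of_eq_zero_off (C := C * C)
      (S := Icc (-L - s) L ×ˢ (Icc (-L) L ×ˢ Icc (-L) L)) hAm.aestronglyMeasurable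
      (measurableSet_Icc.prod (measurableSet_Icc.prod measurableSet_Icc)) ?_ ?_ ?_
    · rw [Measure.prod_prod, Measure.volume_eq_prod, Measure.prod_prod]
      simp [Real.volume_Icc, ENNReal.mul_eq_top]
    · rintro ⟨x, u, v⟩
      simp only [Function.uncurry_apply_pair, hA, abs_mul]
      refine mul_le_mul ?_ ?_ (abs_nonneg _) hC0
      · by_cases h : u ∈ Ioc x (x + s)
        · rw [indicator_of_mem h]; exact hηC u
        · rw [indicator_of_notMem h, abs_zero]; exact hC0
      · by_cases h : v ∈ Ioc x (x + s)
        · rw [indicator_of_mem h]; exact hηC v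
        · rw [indicator_of_notMem h, abs_zero]; exact hC0
    · rintro ⟨x, u, v⟩ hq
      simp only [Function.uncurry_apply_pair, hA]
      by_contra hne
      rcases mul_ne_zero_iff.mp hne with ⟨hu, hv⟩
      have hu' : u ∈ Ioc x (x + s) := by
        by_contra h; exact hu (indicator_of_notMem h _)
      have hv' : v ∈ Ioc x (x + s) := by
        by_contra h; exact hv (indicator_of_notMem h _)
      rw [indicator_of_mem hu'] at hu
      rw [indicator_of_mem hv'] at hv
      have hu2 : u ∈ Icc (-L) L := by by_contra h; exact hu (hη0 u h)
      have hv2 : v ∈ Icc (-L) L := by by_contra h; exact hv (hη0 v h)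
      refine hq ⟨⟨?_, ?_⟩, hu2, hv2⟩
      · linarith [hu'.2, hu2.1]
      · linarith [hu'.1, hu2.2]
  rw [Measure.volume_eq_prod] at hAint ⊢
  have hswap := integral_integral_swap hAint
  simp only [hA] at hswap
  rw [hswap]
  refine integral_congr_ae (Eventually.of_forall fun p => ?_)
  simp only
  simp_rw [indicator_Ioc_mul_indicator_Ioc η s p.1 p.2]
  rw [integral_indicator_const _ measurableSet_Ico, volume_real_Ico_max_sub_min, smul_eq_mul]
  ring

/-! ### The layer kernel `k_R(r) = ∫₀ᴿ (s - r)₊ s⁻² ds = log R - log r - 1 + r/R` -/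

/-- Integrability of `s ↦ (s - r)₊ / s²` on `[0, R]` for `r > 0` (it vanishes on `[0, r]` and is
continuous on `[r, ∞)`). [folklore] -/
theorem intervalIntegrable_posPart_div_sq {r : ℝ} (hr : 0 < r) (R : ℝ) :
    IntervalIntegrable (fun s => max (s - r) 0 / s ^ 2) volume 0 R := by
  have hzero : ∀ b, b ≤ r → IntervalIntegrable (fun s => max (s - r) 0 / s ^ 2) volume 0 b := by
    intro b hb
    refine (intervalIntegrable_congr fun s hs => ?_).mp (intervalIntegrable_const (c := (0 : ℝ)))
    have hs' : s ≤ r := by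
      rcases mem_uIoc.mp hs with h | h
      · exact h.2.trans hb
      · linarith [h.2]
    simp [max_eq_right (sub_nonpos.mpr hs')]
  have hcont : ∀ b, r ≤ b → IntervalIntegrable (fun s => max (s - r) 0 / s ^ 2) volume r b := by
    intro b hb
    refine ContinuousOn.intervalIntegrable fun s hs => ?_
    rw [uIcc_of_le hb] at hs
    have hs0 : s ^ 2 ≠ 0 := pow_ne_zero 2 (hr.trans_le hs.1).ne'
    exact (((continuous_id.sub continuous_const).max continuous_const).continuousAt.div
      ((continuous_pow 2).continuousAt) hs0).continuousWithinAt
  rcases le_total R r with hR | hR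
  · exact hzero R hR
  · exact (hzero r le_rfl).trans (hcont R hR)

/-- **`∫₀ᴿ (s - r)₊/s² ds = log R - log r - 1 + r/R`** for `0 < r ≤ R` (antiderivative
`log s + r/s` on `[r, R]`). [folklore] -/
theorem integral_posPart_div_sq {r R : ℝ} (hr : 0 < r) (hrR : r ≤ R) :
    ∫ s in (0:ℝ)..R, max (s - r) 0 / s ^ 2 = Real.log R - Real.log r - 1 + r / R := by
  rw [← integral_add_adjacent_intervals (intervalIntegrable_posPart_div_sq hr r)
    ((intervalIntegrable_posPart_div_sq hr r).symm.trans (intervalIntegrable_posPart_div_sq hr R))]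
  have h0 : ∫ s in (0:ℝ)..r, max (s - r) 0 / s ^ 2 = 0 := by
    rw [integral_of_le hr.le]
    refine (setIntegral_congr_fun measurableSet_Ioc fun s hs => ?_).trans (integral_zero _ _)
    simp [max_eq_right (sub_nonpos.mpr hs.2)]
  have heq : EqOn (fun s => max (s - r) 0 / s ^ 2) (fun s => s⁻¹ + r * -(s ^ 2)⁻¹) (uIcc r R) := by
    intro s hs
    rw [uIcc_of_le hrR] at hs
    have hs0 : s ≠ 0 := (hr.trans_le hs.1).ne'
    simp only
    rw [max_eq_left (sub_nonneg.mpr hs.1)]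
    field_simp
    ring
  have hderiv : ∀ s ∈ uIcc r R,
      HasDerivAt (fun s => Real.log s + r * s⁻¹) (s⁻¹ + r * -(s ^ 2)⁻¹) s := by
    intro s hs
    rw [uIcc_of_le hrR] at hs
    have hs0 : s ≠ 0 := (hr.trans_le hs.1).ne'
    exact (Real.hasDerivAt_log hs0).add ((hasDerivAt_inv hs0).const_mul r)
  have hint : IntervalIntegrable (fun s => s⁻¹ + r * -(s ^ 2)⁻¹) volume r R :=
    ((intervalIntegrable_posPart_div_sq hr r).symm.trans
      (intervalIntegrable_posPart_div_sq hr R)).congr (heq.mono uIoc_subset_uIcc)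
  rw [h0, zero_add, integral_congr heq, integral_eq_sub_of_hasDerivAt hderiv hint,
    mul_inv_cancel₀ hr.ne']
  ring

/-- Lebesgue-almost every point of the plane is off the diagonal. [folklore] -/
theorem ae_fst_ne_snd : ∀ᵐ p : ℝ × ℝ, p.1 ≠ p.2 := by
  have hS : MeasurableSet {p : ℝ × ℝ | p.1 = p.2} :=
    measurableSet_eq_fun measurable_fst measurable_snd
  have h0 : volume {p : ℝ × ℝ | p.1 = p.2} = 0 := by
    rw [Measure.volume_eq_prod, Measure.prod_apply hS]
    have h1 : ∀ x : ℝ, volume (Prod.mk x ⁻¹' {p : ℝ × ℝ | p.1 = p.2}) = 0 := fun x => by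
      have : Prod.mk x ⁻¹' {p : ℝ × ℝ | p.1 = p.2} = {x} := by
        ext y; simp [eq_comm]
      rw [this, Real.volume_singleton]
    simp only [h1, lintegral_const, zero_mul]
  rw [ae_iff]
  simpa using h0

/-- From interval integrability to integrability on the closed interval. [folklore] -/
theorem integrableOn_Icc_of_intervalIntegrable {f : ℝ → ℝ} {a b : ℝ} (hab : a ≤ b)
    (h : IntervalIntegrable f volume a b) : IntegrableOn f (Icc a b) :=
  (integrableOn_Icc_iff_integrableOn_Ioc).mpr ((intervalIntegrable_iff_integrableOn_Ioc_of_le hab).mp h)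

/-- The layer kernel in closed form, `κ_R(t) = log R - log|t| - 1 + |t|/R`, is integrable on every
`[a, b]`. [folklore] -/
theorem integrableOn_logLayerKernel (R a b : ℝ) (hab : a ≤ b) :
    IntegrableOn (fun t => Real.log R - Real.log |t| - 1 + |t| / R) (Icc a b) := by
  refine integrableOn_Icc_of_intervalIntegrable hab ?_
  simp_rw [Real.log_abs]
  refine ((intervalIntegrable_const.sub intervalIntegrable_log').sub intervalIntegrable_const).add ?_
  exact (continuous_abs.div_const R).intervalIntegrable _ _

/-- Measurability of the closed-form layer kernel. [folklore] -/
theorem measurable_logLayerKernel (R : ℝ) :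
    Measurable fun t : ℝ => Real.log R - Real.log |t| - 1 + |t| / R := by
  fun_prop

/-- **Integrability of the layer integrand** `(s, (u, v)) ↦ η(u) η(v) (s - |u-v|)₊ / s²` on
`(0, R] × ℝ²`, for a bounded measurable `η` vanishing off `[-L, L]` and `R ≥ 2L`: for a.e. `(u, v)`
the `s`-integral of its absolute value is `|η(u)η(v)| κ_R(u - v)` with the integrable kernel
`κ_R(t) = log R - log|t| - 1 + |t|/R`. [folklore] -/
theorem integrable_layerIntegrand {η : ℝ → ℝ} {C L R : ℝ} (hηm : Measurable η)
    (hηC : ∀ x, |η x| ≤ C) (hη0 : ∀ x ∉ Icc (-L) L, η x = 0) (hL : 0 ≤ L) (hR0 : 0 < R)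
    (hR : 2 * L ≤ R) :
    Integrable (fun q : ℝ × (ℝ × ℝ) =>
        η q.2.1 * η q.2.2 * (max (q.1 - |q.2.1 - q.2.2|) 0 / q.1 ^ 2))
      ((volume.restrict (Ioc 0 R)).prod volume) := by
  have hmeas : Measurable fun q : ℝ × (ℝ × ℝ) =>
      η q.2.1 * η q.2.2 * (max (q.1 - |q.2.1 - q.2.2|) 0 / q.1 ^ 2) :=
    ((hηm.comp measurable_snd.fst).mul (hηm.comp measurable_snd.snd)).mul
      (((measurable_fst.sub (continuous_abs.measurable.comp
        (measurable_snd.fst.sub measurable_snd.snd))).max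
        measurable_const).div (measurable_fst.pow_const 2))
  rw [integrable_prod_iff' hmeas.aestronglyMeasurable]
  constructor
  · filter_upwards [ae_fst_ne_snd] with p hp
    have hr : 0 < |p.1 - p.2| := abs_pos.mpr (sub_ne_zero.mpr hp)
    have hi := intervalIntegrable_posPart_div_sq hr R
    rw [intervalIntegrable_iff_integrableOn_Ioc_of_le hR0.le] at hi
    exact hi.const_mul (η p.1 * η p.2)
  · have hae : (fun p : ℝ × ℝ => ∫ s in Ioc 0 R,
          ‖η p.1 * η p.2 * (max (s - |p.1 - p.2|) 0 / s ^ 2)‖) =ᵐ[volume]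
        fun p => |η p.1| * |η p.2| *
          (Real.log R - Real.log |p.1 - p.2| - 1 + |p.1 - p.2| / R) := by
      filter_upwards [ae_fst_ne_snd] with p hp
      by_cases hz : η p.1 * η p.2 = 0
      · have hz' : |η p.1| * |η p.2| = 0 := by rw [← abs_mul, hz, abs_zero]
        simp [hz, hz']
      · have h1 : p.1 ∈ Icc (-L) L := by
          by_contra h; exact hz (by rw [hη0 _ h, zero_mul])
        have h2 : p.2 ∈ Icc (-L) L := by
          by_contra h; exact hz (by rw [hη0 _ h, mul_zero])
        have hr : 0 < |p.1 - p.2| := abs_pos.mpr (sub_ne_zero.mpr hp)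
        have hrR : |p.1 - p.2| ≤ R := by
          rw [abs_sub_le_iff]; constructor <;> linarith [h1.1, h1.2, h2.1, h2.2]
        have hnn : ∀ s : ℝ, ‖η p.1 * η p.2 * (max (s - |p.1 - p.2|) 0 / s ^ 2)‖ =
            |η p.1| * |η p.2| * (max (s - |p.1 - p.2|) 0 / s ^ 2) := by
          intro s
          rw [Real.norm_eq_abs, abs_mul, abs_mul,
            abs_of_nonneg (div_nonneg (le_max_right _ _) (sq_nonneg s))]
        simp_rw [hnn]
        rw [MeasureTheory.integral_const_mul, ← integral_of_le hR0.le, integral_posPart_div_sq hr hrR]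
    rw [integrable_congr hae]
    have habsm : Measurable fun x => |η x| := continuous_abs.measurable.comp hηm
    have h := integrable_mul_mul_kernel (C := C) (L := L)
      (κ := fun t => Real.log R - Real.log |t| - 1 + |t| / R) habsm habsm (measurable_logLayerKernel R) (fun x => by rw [abs_abs]; exact hηC x)
      (fun x => by rw [abs_abs]; exact hηC x)
      (fun x hx => by simp [hη0 x hx]) (fun x hx => by simp [hη0 x hx])
      (integrableOn_logLayerKernel R _ _ (by linarith))
    rw [Measure.volume_eq_prod]
    exact h

/-- **The layer identity.** For a bounded measurable `η` vanishing off `[-L, L]` and `R ≥ 2L > 0`: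
`∫₀ᴿ s⁻² (∫ (∫_x^{x+s} η)² dx) ds = ∬ η(u) η(v) (log R - log|u-v| - 1 + |u-v|/R) du dv`
(square identity, Fubini, and the layer kernel in closed form). [folklore] -/
theorem integral_sq_div_sq_eq_kernel {η : ℝ → ℝ} {C L R : ℝ} (hηm : Measurable η)
    (hηC : ∀ x, |η x| ≤ C) (hη0 : ∀ x ∉ Icc (-L) L, η x = 0) (hL : 0 ≤ L) (hR0 : 0 < R)
    (hR : 2 * L ≤ R) :
    ∫ s in (0:ℝ)..R, (∫ x, (∫ t in x..x + s, η t) ^ 2) / s ^ 2 =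
      ∫ p : ℝ × ℝ, η p.1 * η p.2 * (Real.log R - Real.log |p.1 - p.2| - 1 + |p.1 - p.2| / R) := by
  have hA : EqOn (fun s => (∫ x, (∫ t in x..x + s, η t) ^ 2) / s ^ 2)
      (fun s => ∫ p : ℝ × ℝ, η p.1 * η p.2 * (max (s - |p.1 - p.2|) 0 / s ^ 2)) (uIcc 0 R) := by
    intro s hs
    rw [uIcc_of_le hR0.le] at hs
    simp only
    rw [integral_sq_intervalIntegral_eq hηm hηC hη0 hs.1, ← MeasureTheory.integral_div]
    refine integral_congr_ae (Eventually.of_forall fun p => ?_)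
    simp only
    ring
  rw [integral_congr hA, integral_of_le hR0.le]
  have hint := integrable_layerIntegrand hηm hηC hη0 hL hR0 hR
  have hswap := integral_integral_swap (f := fun (s : ℝ) (p : ℝ × ℝ) =>
    η p.1 * η p.2 * (max (s - |p.1 - p.2|) 0 / s ^ 2)) hint
  rw [hswap]
  refine integral_congr_ae ?_
  filter_upwards [ae_fst_ne_snd] with p hp
  by_cases hz : η p.1 * η p.2 = 0
  · simp [hz]
  · have h1 : p.1 ∈ Icc (-L) L := by
      by_contra h; exact hz (by rw [hη0 _ h, zero_mul])
    have h2 : p.2 ∈ Icc (-L) L := by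
      by_contra h; exact hz (by rw [hη0 _ h, mul_zero])
    have hr : 0 < |p.1 - p.2| := abs_pos.mpr (sub_ne_zero.mpr hp)
    have hrR : |p.1 - p.2| ≤ R := by
      rw [abs_sub_le_iff]; constructor <;> linarith [h1.1, h1.2, h2.1, h2.2]
    rw [MeasureTheory.integral_const_mul, ← integral_of_le hR0.le, integral_posPart_div_sq hr hrR]

/-! ### The inequality: log-energy of a neutral density dominates its local `H^{1/2}` layers -/

/-- Integrability of `s ↦ s⁻² ∫ (∫_x^{x+s} η)² dx` on `[0, R]` (a marginal of the layer integrand).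
[folklore] -/
theorem intervalIntegrable_sq_div_sq {η : ℝ → ℝ} {C L R : ℝ} (hηm : Measurable η)
    (hηC : ∀ x, |η x| ≤ C) (hη0 : ∀ x ∉ Icc (-L) L, η x = 0) (hL : 0 ≤ L) (hR0 : 0 < R)
    (hR : 2 * L ≤ R) :
    IntervalIntegrable (fun s => (∫ x, (∫ t in x..x + s, η t) ^ 2) / s ^ 2) volume 0 R := by
  rw [intervalIntegrable_iff_integrableOn_Ioc_of_le hR0.le]
  have h := (integrable_layerIntegrand hηm hηC hη0 hL hR0 hR).integral_prod_left
  refine IntegrableOn.congr_fun h (fun s hs => ?_) measurableSet_Ioc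
  simp only
  rw [integral_sq_intervalIntegral_eq hηm hηC hη0 hs.1.le, ← MeasureTheory.integral_div]
  refine integral_congr_ae (Eventually.of_forall fun p => ?_)
  simp only
  ring

/-- **Positivity of the logarithmic energy of a neutral density, with the local `H^{1/2}` remainder.**
For a bounded measurable `η` vanishing off `[-L, L]` with `∫ η = 0`:
`∫₀¹ s⁻² (∫ (∫_x^{x+s} η)² dx) ds ≤ -∬ η(u) η(v) log|u - v| du dv`.
(Layer identity with `R → ∞`: `∫₀ᴿ s⁻² D(s) ds = -∬ ηη log|u-v| + R⁻¹ ∬ ηη |u-v|` since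
`(log R - 1)(∫η)² = 0`, and `D ≥ 0`.) The classical statement is the positivity of the logarithmic
energy of a neutral signed measure (e.g. Saff–Totik, *Logarithmic Potentials*, Lemma I.1.8); the
`H^{1/2}` form `-∬ log|x-y| g'g' = ½‖g‖²_{1/2}` is Vershik–Kerov 1985, Lemma 3. [folklore] -/
theorem integral_sq_div_sq_le_neg_logEnergy {η : ℝ → ℝ} {C L : ℝ} (hηm : Measurable η)
    (hηC : ∀ x, |η x| ≤ C) (hη0 : ∀ x ∉ Icc (-L) L, η x = 0) (hL : 0 ≤ L)
    (hint : ∫ x, η x = 0) :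
    ∫ s in (0:ℝ)..1, (∫ x, (∫ t in x..x + s, η t) ^ 2) / s ^ 2 ≤
      -∫ p : ℝ × ℝ, η p.1 * η p.2 * Real.log |p.1 - p.2| := by
  set E : ℝ := ∫ p : ℝ × ℝ, η p.1 * η p.2 * Real.log |p.1 - p.2| with hE
  set β : ℝ := ∫ p : ℝ × ℝ, η p.1 * η p.2 * |p.1 - p.2| with hβ
  -- integrability of the three kernels
  have hIlog : Integrable (fun p : ℝ × ℝ => η p.1 * η p.2 * Real.log |p.1 - p.2|)
      (volume.prod volume) := by
    refine integrable_mul_mul_kernel (κ := fun t => Real.log |t|) hηm hηm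
      (Real.measurable_log.comp continuous_abs.measurable) hηC hηC hη0 hη0
      (integrableOn_Icc_of_intervalIntegrable (by linarith) ?_)
    simp_rw [Real.log_abs]
    exact intervalIntegrable_log'
  have hIabs : Integrable (fun p : ℝ × ℝ => η p.1 * η p.2 * |p.1 - p.2|) (volume.prod volume) :=
    integrable_mul_mul_kernel (κ := fun t => |t|) hηm hηm continuous_abs.measurable hηC hηC hη0
      hη0 (continuous_abs.continuousOn.integrableOn_compact isCompact_Icc)
  have hIconst : ∀ a : ℝ, Integrable (fun p : ℝ × ℝ => η p.1 * η p.2 * a)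
      (volume.prod volume) := fun a =>
    integrable_mul_mul_kernel (κ := fun _ => a) hηm hηm measurable_const hηC hηC hη0 hη0
      (continuous_const.continuousOn.integrableOn_compact isCompact_Icc)
  have hconst : ∀ a : ℝ, ∫ p : ℝ × ℝ, η p.1 * η p.2 * a = 0 := by
    intro a
    have h := integral_prod_mul (μ := volume) (ν := volume) η (fun y => η y * a)
    rw [hint, zero_mul] at h
    rw [Measure.volume_eq_prod, ← h]
    refine integral_congr_ae (Eventually.of_forall fun p => ?_)
    simp only
    ring
  -- the layer identity for every large `R`
  have key : ∀ R, 0 < R → 2 * L ≤ R →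
      ∫ s in (0:ℝ)..R, (∫ x, (∫ t in x..x + s, η t) ^ 2) / s ^ 2 = -E + β / R := by
    intro R hR0 hR
    rw [integral_sq_div_sq_eq_kernel hηm hηC hη0 hL hR0 hR]
    have hsplit : ∀ p : ℝ × ℝ,
        η p.1 * η p.2 * (Real.log R - Real.log |p.1 - p.2| - 1 + |p.1 - p.2| / R) =
          η p.1 * η p.2 * (Real.log R - 1) - η p.1 * η p.2 * Real.log |p.1 - p.2| +
            R⁻¹ * (η p.1 * η p.2 * |p.1 - p.2|) := by
      intro p; ring
    simp_rw [hsplit]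
    rw [MeasureTheory.integral_add, MeasureTheory.integral_sub, MeasureTheory.integral_const_mul,
      hconst, zero_sub, hE, hβ]
    · ring
    · rw [Measure.volume_eq_prod]; exact hIconst _
    · rw [Measure.volume_eq_prod]; exact hIlog
    · rw [Measure.volume_eq_prod]; exact (hIconst _).sub hIlog
    · rw [Measure.volume_eq_prod]; exact (hIabs.const_mul _)
  -- monotonicity in `R`
  have hnonneg : ∀ s, 0 ≤ (∫ x, (∫ t in x..x + s, η t) ^ 2) / s ^ 2 := fun s =>
    div_nonneg (integral_nonneg fun x => sq_nonneg _) (sq_nonneg _)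
  have hmono : ∀ R, 1 ≤ R → 2 * L ≤ R →
      ∫ s in (0:ℝ)..1, (∫ x, (∫ t in x..x + s, η t) ^ 2) / s ^ 2 ≤ -E + β / R := by
    intro R hR1 hR
    rw [← key R (by linarith) hR]
    exact integral_mono_interval le_rfl zero_le_one hR1 (Eventually.of_forall hnonneg)
      (intervalIntegrable_sq_div_sq hηm hηC hη0 hL (by linarith) hR)
  -- let `R → ∞`
  refine le_of_forall_pos_le_add fun ε hε => ?_
  set R : ℝ := max (max (2 * L) 1) (|β| / ε) with hR
  have hR1 : 1 ≤ R := (le_max_right _ _).trans (le_max_left _ _)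
  have hR2 : 2 * L ≤ R := (le_max_left _ _).trans (le_max_left _ _)
  have hR3 : |β| / ε ≤ R := le_max_right _ _
  have hRpos : 0 < R := by linarith
  refine (hmono R hR1 hR2).trans ?_
  have hb : β / R ≤ ε := by
    rw [div_le_iff₀ hRpos]
    calc β ≤ |β| := le_abs_self β
      _ = |β| / ε * ε := by field_simp
      _ ≤ R * ε := mul_le_mul_of_nonneg_right hR3 hε.le
      _ = ε * R := mul_comm _ _
  linarith

/-! ### The local lower bound on unit slots -/

/-- On a slot `[k, k+1)` where `η` keeps a sign and `|η| ≥ n ≥ 0`, every window integral over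
`(x, x+s) ⊆ (k, k+1)` has `(∫_x^{x+s} η)² ≥ (n s)²`. [cite: VershikKerov1985, §3] -/
theorem sq_le_sq_intervalIntegral_of_sign {η : ℝ → ℝ} {k n x s : ℝ} (hn : 0 ≤ n) (hs : 0 ≤ s)
    (hη : IntervalIntegrable η volume x (x + s)) (hkx : k ≤ x) (hxs : x + s ≤ k + 1)
    (hsgn : (∀ y ∈ Ioo k (k + 1), n ≤ η y) ∨ (∀ y ∈ Ioo k (k + 1), η y ≤ -n)) :
    (n * s) ^ 2 ≤ (∫ t in x..x + s, η t) ^ 2 := by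
  have hsub : ∀ y ∈ Ioo x (x + s), y ∈ Ioo k (k + 1) := fun y hy =>
    ⟨lt_of_le_of_lt hkx hy.1, lt_of_lt_of_le hy.2 hxs⟩
  have hc : ∫ _ in x..x + s, n = n * s := by simp [mul_comm]
  rcases hsgn with h | h
  · have h1 : n * s ≤ ∫ t in x..x + s, η t := by
      rw [← hc]
      exact integral_mono_on_of_le_Ioo (by linarith) intervalIntegrable_const hη
        fun y hy => h y (hsub y hy)
    exact pow_le_pow_left₀ (mul_nonneg hn hs) h1 2
  · have h1 : ∫ t in x..x + s, η t ≤ -(n * s) := by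
      have hc' : ∫ _ in x..x + s, -n = -(n * s) := by simp [mul_comm]
      rw [← hc']
      exact integral_mono_on_of_le_Ioo (by linarith) hη intervalIntegrable_const
        fun y hy => h y (hsub y hy)
    have h2 : n * s ≤ -∫ t in x..x + s, η t := by linarith
    calc (n * s) ^ 2 ≤ (-∫ t in x..x + s, η t) ^ 2 := pow_le_pow_left₀ (mul_nonneg hn hs) h2 2
      _ = (∫ t in x..x + s, η t) ^ 2 := by ring

/-- A bounded measurable function vanishing off `[-L, L]` is integrable. [folklore] -/
theorem integrable_of_bounded_Icc {η : ℝ → ℝ} {C L : ℝ} (hηm : Measurable η)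
    (hηC : ∀ x, |η x| ≤ C) (hη0 : ∀ x ∉ Icc (-L) L, η x = 0) : Integrable η :=
  integrable_of_bounded_of_eq_zero_off hηm.aestronglyMeasurable measurableSet_Icc (by simp) hηC hη0

/-- The window integral `x ↦ ∫_x^{x+s} η` is continuous. [folklore] -/
theorem continuous_windowIntegral {η : ℝ → ℝ} {C L : ℝ} (hηm : Measurable η)
    (hηC : ∀ x, |η x| ≤ C) (hη0 : ∀ x ∉ Icc (-L) L, η x = 0) (s : ℝ) :
    Continuous fun x => ∫ t in x..x + s, η t := by
  have hi : ∀ a b, IntervalIntegrable η volume a b := fun a b =>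
    (integrable_of_bounded_Icc hηm hηC hη0).intervalIntegrable
  have heq : (fun x => ∫ t in x..x + s, η t) =
      fun x => (∫ t in (0:ℝ)..x + s, η t) - ∫ t in (0:ℝ)..x, η t := by
    ext x; rw [integral_interval_sub_left (hi _ _) (hi _ _)]
  rw [heq]
  exact ((continuous_primitive hi 0).comp (continuous_add_const s)).sub (continuous_primitive hi 0)

/-- The squared window integral `x ↦ (∫_x^{x+s} η)²` is integrable (`s ≥ 0`). [folklore] -/
theorem integrable_sq_windowIntegral {η : ℝ → ℝ} {C L s : ℝ} (hηm : Measurable η)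
    (hηC : ∀ x, |η x| ≤ C) (hη0 : ∀ x ∉ Icc (-L) L, η x = 0) (hs : 0 ≤ s) :
    Integrable fun x => (∫ t in x..x + s, η t) ^ 2 := by
  refine integrable_of_bounded_of_eq_zero_off (C := (C * s) ^ 2) (S := Icc (-L - s) L)
    ((continuous_windowIntegral hηm hηC hη0 s).pow 2).aestronglyMeasurable measurableSet_Icc
    (by simp) (fun x => ?_) (fun x hx => ?_)
  · rw [abs_of_nonneg (sq_nonneg _), ← sq_abs]
    refine pow_le_pow_left₀ (abs_nonneg _) ?_ 2
    have h := norm_integral_le_of_norm_le_const (a := x) (b := x + s) (C := C) (f := η)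
      fun t _ => by rw [Real.norm_eq_abs]; exact hηC t
    rw [Real.norm_eq_abs, add_sub_cancel_left, abs_of_nonneg hs] at h
    exact h
  · rw [sq_eq_zero_iff, integral_of_le (by linarith)]
    refine (setIntegral_congr_fun measurableSet_Ioc fun t ht => hη0 t fun ht' => hx ?_).trans
      (integral_zero _ _)
    exact ⟨by linarith [ht.2, ht'.1], by linarith [ht.1, ht'.2]⟩

/-- **The local (diagonal-slots) lower bound.** If on each unit slot `[k, k+1)`, `k ∈ K ⊆ ℤ`, the
density `η` keeps a sign and `|η| ≥ n_k ≥ 0`, then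
`½ ∑_{k ∈ K} n_k² ≤ ∫₀¹ s⁻² (∫ (∫_x^{x+s} η)² dx) ds` (restrict `x` to `⋃_k [k, k+1-s]`, where
`(∫_x^{x+s} η)² ≥ n_k² s²`, and integrate `∫₀¹ (1-s) ds = ½`). This is Vershik–Kerov's "diagonal
unit squares" estimate in layer form. [cite: VershikKerov1985, §3] -/
theorem sum_sq_div_two_le_integral_sq_div_sq {η : ℝ → ℝ} {C L : ℝ} (hηm : Measurable η)
    (hηC : ∀ x, |η x| ≤ C) (hη0 : ∀ x ∉ Icc (-L) L, η x = 0) (hL : 0 ≤ L)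
    (K : Finset ℤ) (n : ℤ → ℝ) (hn : ∀ k ∈ K, 0 ≤ n k)
    (hsgn : ∀ k ∈ K, (∀ y ∈ Ioo (k : ℝ) (k + 1), n k ≤ η y) ∨
      (∀ y ∈ Ioo (k : ℝ) (k + 1), η y ≤ -n k)) :
    (∑ k ∈ K, n k ^ 2) / 2 ≤ ∫ s in (0:ℝ)..1, (∫ x, (∫ t in x..x + s, η t) ^ 2) / s ^ 2 := by
  have hi : ∀ a b, IntervalIntegrable η volume a b := fun a b =>
    (integrable_of_bounded_Icc hηm hηC hη0).intervalIntegrable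
  -- pointwise in `s ∈ (0, 1)`
  have hpt : ∀ s ∈ Ioo (0:ℝ) 1,
      (1 - s) * ∑ k ∈ K, n k ^ 2 ≤ (∫ x, (∫ t in x..x + s, η t) ^ 2) / s ^ 2 := by
    intro s hs
    have hs0 : 0 < s := hs.1
    rw [le_div_iff₀ (pow_pos hs0 2)]
    set f : ℝ → ℝ := fun x => (∫ t in x..x + s, η t) ^ 2 with hf
    have hfint : Integrable f := integrable_sq_windowIntegral hηm hηC hη0 hs0.le
    set I : ℤ → Set ℝ := fun k => Icc (k : ℝ) (k + 1 - s) with hI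
    have hdisj : Set.Pairwise (↑K : Set ℤ) (Function.onFun Disjoint I) := by
      intro k _ k' _ hkk'
      simp only [Function.onFun, hI]
      rw [Set.disjoint_left]
      intro x hx hx'
      rcases lt_or_gt_of_ne hkk' with h | h
      · have h1 : (k : ℝ) + 1 ≤ k' := by exact_mod_cast h
        linarith [hx.2, hx'.1]
      · have h1 : (k' : ℝ) + 1 ≤ k := by exact_mod_cast h
        linarith [hx'.2, hx.1]
    -- the integral over the union of slots
    have h1 : ∫ x in ⋃ k ∈ K, I k, f x ≤ ∫ x, f x :=
      setIntegral_le_integral hfint (Eventually.of_forall fun x => sq_nonneg _)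
    have h2 : ∫ x in ⋃ k ∈ K, I k, f x = ∑ k ∈ K, ∫ x in I k, f x :=
      integral_biUnion_finset K (fun k _ => measurableSet_Icc) hdisj
        (fun k _ => hfint.integrableOn)
    have h3 : ∀ k ∈ K, (n k * s) ^ 2 * (1 - s) ≤ ∫ x in I k, f x := by
      intro k hk
      have hvol : volume.real (I k) = 1 - s := by
        simp only [hI]
        rw [Real.volume_real_Icc_of_le (by linarith [hs.2])]
        ring
      calc (n k * s) ^ 2 * (1 - s) = ∫ _ in I k, (n k * s) ^ 2 := by
            rw [setIntegral_const, hvol, smul_eq_mul, mul_comm]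
        _ ≤ ∫ x in I k, f x := by
            refine setIntegral_mono_on (integrableOn_const (by simp [hI])) hfint.integrableOn
              measurableSet_Icc fun x hx => ?_
            exact sq_le_sq_intervalIntegral_of_sign (hn k hk) hs0.le (hi _ _) hx.1
              (by linarith [hx.2]) (hsgn k hk)
    calc (1 - s) * (∑ k ∈ K, n k ^ 2) * s ^ 2 = ∑ k ∈ K, (n k * s) ^ 2 * (1 - s) := by
          rw [Finset.mul_sum, Finset.sum_mul]
          refine Finset.sum_congr rfl fun k _ => ?_
          ring
      _ ≤ ∑ k ∈ K, ∫ x in I k, f x := Finset.sum_le_sum h3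
      _ ≤ ∫ x, f x := by rw [← h2]; exact h1
  -- integrate over `s ∈ (0, 1)`
  have hR : IntervalIntegrable (fun s => (∫ x, (∫ t in x..x + s, η t) ^ 2) / s ^ 2) volume 0 1 := by
    have h := intervalIntegrable_sq_div_sq hηm hηC hη0 hL (R := max (2 * L) 1)
      (lt_of_lt_of_le zero_lt_one (le_max_right _ _)) (le_max_left _ _)
    exact h.mono_set (by
      rw [uIcc_of_le zero_le_one, uIcc_of_le (zero_le_one.trans (le_max_right _ _))]
      exact Icc_subset_Icc le_rfl (le_max_right _ _))
  have hlhs : ∫ s in (0:ℝ)..1, (1 - s) * ∑ k ∈ K, n k ^ 2 = (∑ k ∈ K, n k ^ 2) / 2 := by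
    have h1 : ∫ s in (0:ℝ)..1, (1 - s) = 1 / 2 := by
      have h := intervalIntegral.integral_sub (μ := volume) (a := (0:ℝ)) (b := 1)
        (f := fun _ => (1:ℝ)) (g := fun s => s) intervalIntegrable_const
        (continuous_id.intervalIntegrable _ _)
      simp only [intervalIntegral.integral_const, integral_id] at h
      rw [h]
      norm_num
    rw [intervalIntegral.integral_mul_const, h1]
    ring
  rw [← hlhs]
  refine integral_mono_on_of_le_Ioo zero_le_one (Continuous.intervalIntegrable ?_ _ _) hR hpt
  fun_prop

end Literature.Analysis.Potential

end
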